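import Mathlib.Data.Nat.Find
import Mathlib.Order.Basic
import HarnessLib

/-!
# No bad triple + no `abab` ⇒ monotone off one cut (witness unit U5e)

Crux `SAWLeftRightFKG.FKGToTraversalBound` (stmt-CriticalPhenomena-1878), line `slit-necklace`, witness
unit U5e of the planar-witness stub `stub_necklaceWitnessFarU`
(lead prover-line-stmt-CriticalPhenomena-1878-c5-0).

Pure combinatorics on `ℕ`, Mathlib only.  Positions `p : ℕ` live on a cycle of length `N`; `good p`
("position `p` carries an obstacle contact") and `idx p` (its index on the obstacle) are `N`-periodic.
Hypotheses: NO BAD TRIPLE (`x < y < z < x + N` good with `idx x < idx z` and `idx y` outside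
`[idx x, idx z]`) and NO `abab` VALUES (four good positions `p₁ < p₂ < p₃ < p₄ < N` reading
`a, b, a, b` with `a ≠ b`).  Conclusion: `idx` is non-decreasing on the good positions of `[0, N)`
except across ONE cut `kcut`.

Proof.  An *inversion* is a pair of good positions `q < q' < N` with `idx q' < idx q`.  The key step
(`no_two_inversions`) is that there are no two inversions `(q₁, q₁')`, `(q₂, q₂')` with
`q₁ < q₁' ≤ q₂ < q₂' < N`: writing `a > b`, `c > d` for their values, every relative position of
`b, c`, then `c, a`, then `d, b` yields either a bad triple (possibly through the rotated position
`q₁ + N`, good with value `a` by periodicity) or, when `c = a` and `d = b`, an `abab` pattern.  The cut is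
then the first landing position `q'` of an inversion (or `0` if there is none): pairs landing before it
are not inversions by minimality, and an inversion starting at or after it would be a second, disjoint
inversion.
-/

noncomputable section

namespace Summit.CriticalPhenomena.SAWScalingLimit.Theorems.FKGToTraversalBound.SlitNecklace

/-- **No two disjoint inversions.**  Under the no-bad-triple hypothesis (cyclic, through the
`N`-periodicity of `good` and `idx`) and the no-`abab` hypothesis, there are no good positions
`q₁ < q₁' ≤ q₂ < q₂' < N` with `idx q₁' < idx q₁` and `idx q₂' < idx q₂`. [folklore] -/
private theorem no_two_inversions {N : ℕ} {good : ℕ → Prop} {idx : ℕ → ℕ}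
    (htri : ∀ x y z, x < y → y < z → z < x + N → good x → good y → good z →
      ¬ (idx x < idx z ∧ (idx y < idx x ∨ idx z < idx y)))
    (hgood : ∀ p, good (p + N) ↔ good p) (hidx : ∀ p, idx (p + N) = idx p)
    (habab : ¬ ∃ p₁ p₂ p₃ p₄, p₁ < p₂ ∧ p₂ < p₃ ∧ p₃ < p₄ ∧ p₄ < N ∧ good p₁ ∧ good p₂ ∧
      good p₃ ∧ good p₄ ∧ idx p₁ = idx p₃ ∧ idx p₂ = idx p₄ ∧ idx p₁ ≠ idx p₂)
    {q₁ q₁' q₂ q₂' : ℕ} (h₁ : q₁ < q₁') (h₁₂ : q₁' ≤ q₂) (h₂ : q₂ < q₂') (h₂N : q₂' < N)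
    (g₁ : good q₁) (g₁' : good q₁') (g₂ : good q₂) (g₂' : good q₂')
    (hab : idx q₁' < idx q₁) (hcd : idx q₂' < idx q₂) : False := by
  -- the rotated copy of `q₁`
  have g₁N : good (q₁ + N) := (hgood q₁).2 g₁
  have i₁N : idx (q₁ + N) = idx q₁ := hidx q₁
  rcases lt_trichotomy (idx q₁') (idx q₂) with hbc | hbc | hbc
  · -- b < c, hence q₁' < q₂
    have h₁₂' : q₁' < q₂ := lt_of_le_of_ne h₁₂ fun h => (h ▸ hbc).false
    rcases lt_trichotomy (idx q₂) (idx q₁) with hca | hca | hca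
    · -- c < a : triple (q₂, q₂', q₁ + N), values (c, d, a)
      exact htri q₂ q₂' (q₁ + N) h₂ (by omega) (by omega) g₂ g₂' g₁N
        ⟨by rw [i₁N]; exact hca, Or.inl hcd⟩
    · -- c = a
      rcases lt_trichotomy (idx q₂') (idx q₁') with hdb | hdb | hdb
      · -- d < b : triple (q₁', q₂', q₁ + N), values (b, d, a)
        exact htri q₁' q₂' (q₁ + N) (by omega) (by omega) (by omega) g₁' g₂' g₁N
          ⟨by rw [i₁N]; exact hab, Or.inl hdb⟩
      · -- d = b : the pattern a b a b with a ≠ b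
        exact habab ⟨q₁, q₁', q₂, q₂', h₁, h₁₂', h₂, h₂N, g₁, g₁', g₂, g₂', hca.symm, hdb.symm,
          hab.ne'⟩
      · -- b < d : triple (q₁', q₂, q₂'), values (b, a, d)
        exact htri q₁' q₂ q₂' h₁₂' h₂ (by omega) g₁' g₂ g₂' ⟨hdb, Or.inr hcd⟩
    · -- a < c : triple (q₁, q₁', q₂), values (a, b, c)
      exact htri q₁ q₁' q₂ h₁ h₁₂' (by omega) g₁ g₁' g₂ ⟨hca, Or.inl hab⟩
  · -- b = c : triple (q₁', q₂', q₁ + N), values (b, d, a)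
    exact htri q₁' q₂' (q₁ + N) (by omega) (by omega) (by omega) g₁' g₂' g₁N
      ⟨by rw [i₁N]; exact hab, Or.inl (by rw [hbc]; exact hcd)⟩
  · -- c < b, hence q₁' < q₂ : triple (q₁', q₂, q₁ + N), values (b, c, a)
    have h₁₂' : q₁' < q₂ := lt_of_le_of_ne h₁₂ fun h => (h ▸ hbc).false
    exact htri q₁' q₂ (q₁ + N) h₁₂' (by omega) (by omega) g₁' g₂ g₁N
      ⟨by rw [i₁N]; exact hab, Or.inl hbc⟩

/-- **Witness unit U5e: no bad triple + no `abab` ⇒ monotone off one cut.**  On a cycle of length `N`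
with `N`-periodic `good` and `idx`, if no good triple `x < y < z < x + N` has `idx x < idx z` with
`idx y` outside `[idx x, idx z]`, and no four good positions `p₁ < p₂ < p₃ < p₄ < N` read `a, b, a, b`
with `a ≠ b`, then there is a cut `kcut` such that `idx` is non-decreasing on the good positions
`p < p' < N` whenever the pair does not straddle the cut (`p' < kcut ∨ kcut ≤ p`). [folklore] -/
theorem blockMonotone_of_noBadTriple_of_noAbab : ∀ (N : ℕ) (good : ℕ → Prop) (idx : ℕ → ℕ), (∀ x y z, x < y → y < z → z < x + N → good x → good y → good z → ¬ (idx x < idx z ∧ (idx y < idx x ∨ idx z < idx y))) → (∀ p, good (p + N) ↔ good p) → (∀ p, idx (p + N) = idx p) → (¬ ∃ p₁ p₂ p₃ p₄, p₁ < p₂ ∧ p₂ < p₃ ∧ p₃ < p₄ ∧ p₄ < N ∧ good p₁ ∧ good p₂ ∧ good p₃ ∧ good p₄ ∧ idx p₁ = idx p₃ ∧ idx p₂ = idx p₄ ∧ idx p₁ ≠ idx p₂) → ∃ kcut : ℕ, ∀ p p', p < p' → p' < N → good p → good p' → (p' < kcut ∨ kcut ≤ p) → idx p ≤ idx p' :=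 by
  intro N good idx htri hgood hidx habab
  classical
  by_cases hex : ∃ q', q' < N ∧ good q' ∧ ∃ q, q < q' ∧ good q ∧ idx q' < idx q
  · -- cut at the first landing position of an inversion
    refine ⟨Nat.find hex, fun p p' hpp' hp'N hp hp' hcut => le_of_not_gt fun hlt => ?_⟩
    rcases hcut with hcut | hcut
    · -- `p'` lands before the cut: `(p, p')` is not an inversion by minimality
      exact Nat.find_min hex hcut ⟨hp'N, hp', p, hpp', hp, hlt⟩
    · -- the cut is at or before `p`: `(p, p')` would be a second, disjoint inversion
      obtain ⟨_, gk, q, hqk, gq, hinv⟩ := Nat.find_spec hex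
      exact no_two_inversions htri hgood hidx habab hqk hcut hpp' hp'N gq gk hp hp' hinv hlt
  · -- no inversion at all: no cut needed
    refine ⟨0, fun p p' hpp' hp'N hp hp' _ => le_of_not_gt fun hlt => ?_⟩
    exact hex ⟨p', hp'N, hp', p, hpp', hp, hlt⟩

end Summit.CriticalPhenomena.SAWScalingLimit.Theorems.FKGToTraversalBound.SlitNecklace

end
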